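import Summits.AnomalousDissipation.AnomalousDissipation.Theorems.SolenoidalFractalHomogenisationLagrangianStepD1TailCertDefs

/-!
# TAIL-CERT — certificate spine for the v17 stub `stub_D1_residueTail` (K1L_D, stmt-AnomalousDissipation-27980)

Planner `ad-ideate-p5` g14 «profile», TAKES-p5-g14 T1 (tenure ad-ideate-p1 g26, 2026-08-29T02:22:46Z).  Numbers of record: `tailcert.py`
(rigorous fraction-interval arithmetic; memo `Lines/onelevel-D1-tail-cert.md`).  Registered target (registry v17, `Lines/onelevel_v17.lean`):

  `stub_D1_residueTail : ∀ ν ∈ Ioc 0 νB₁, ∀ S, NearIso S (10/11) (11/10) → ∀ τ ∈ Icc 0 (1/20), OddSectorial S τ →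
      RelSmall (Sideband.psiStar cubatureWord MB MB_pos ν S − excQS cubatureWord MB S − pairQS S) (excQS cubatureWord MB S) (1/200000)`.

THE CERTIFICATE.  Write the bilinear symbol of the tail as the slot-pair double sum it is by definition of `psiStar` (source slot `j'`,
pickup slot `j`; `excQS` is the diagonal fresh part, `pairQS` the colinear-adjacent fresh part — prover ad-sawtooth-k1loc-p1 g12, lane A1):

  `bsymb (psiStar − excQS − pairQS) (k;p,q) = Σ_{j j'} (e_j·k)(e_{j'}·k) · F_{jj'}(p,q)`.

If every slot-pair form obeys the ν-FREE bound (lane A4; cases A–E of the memo, every factor a landed `Sideband*` lemma + the off-fibre /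
support lemma for the 13 adjacent non-colinear successions)

  `|F_{jj'}(p,q)| ≤ gTab j j' · |P_j p| · |P_{j'} q|`,   `gTab j j' = G₀ · Apick j · Bst j' · exp(−θmin)`,

with `G₀ = 1/(16π⁴·3720)`, `Apick j = √2·τ_j·(2/θ_j²)/(2|m_j|)` (pickup integral, tent factor `K(θ) ≤ 2/θ²`), `Bst j' = 11/(5|m_{j'}|)`
(`‖response‖ ≤ 8π|α|/r`), `θ_j = 4π²(10/11)·MB·τ_j = r·L_j ∈ {28.7, 91.9, 174.4}`, `θmin = 32π²/11`, then ONE weighted Cauchy–Schwarz over the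
676 ordered pairs (`sq_le_of_slotPair`) gives `bsymb² ≤ ε_F²·N̄(k,p)·N̄(k,q)` with `ε_F² = Σ_{jj'} gTab²/(w_j w_{j'})`, `w_j = slotCoef_j·nC_j`, and
`frob_gTab_le` PROVES `ε_F² ≤ (1/23)²` (true value `ε_F = 1.24·10⁻⁷`; Lean chain: `exp(−θmin) ≤ 10⁻¹²`, `π² ∈ [9.8696, 9.8697]`, per-slot
class-3 bounds `UA = 12·10⁸`, `UB = 44·10¹²`), so the landed socket `D1ResidueCert.relSmall_of_Nbar` (ε·ρP = (1/23)·(115/10⁶) = 1/200000) yields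
the registered text: **`residueTail_of_slotPairBounds`** (and `D1Residue_of_slotPairBounds` = the v16 `stub_D1_residue` text via
`D1Residue_of_Nbar_tail`).  A cruder table `gTabC` (pickup WITHOUT in-slot decay, `K → 1/2`) is certified too (`frob_gTabC_le`, ε_F
≤ 1/23: true `8.3·10⁻⁴`, certified `≤ 7.9·10⁻³`), so lane A4 may use the crudest landed bounds.  No sorry; no new definition of substance (tables are abbreviations); NOT a proof of
`stub_D1_residueTail` (the structure identity and the per-pair bounds are p1 g12's A1/A4), of K1L_D or of AD.  Rung F-D1.A0.

Port note (prover ad-k1loc-p3 g8, TAKES-p3 #12, ruling D26-12): part 2/2 of the verbatim port of planner ad-ideate-p5 g14's crux spine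
`Lines/onelevel_D1_tail_cert.lean` (sha16 6dea23411c0a1052): §5 Frobenius weights `frob_gTab_le`/`frob_gTabC_le` ≤ (1/23)², §6 composition with the landed
socket `D1ResidueCert.relSmall_of_Nbar` — `relSmall_tail_of_table`, **`residueTail_of_slotPairBounds`** / `_crude` (conclusion = registry-v17
`stub_D1_residueTail` text verbatim), `D1Residue_of_slotPairBounds` (v16 `stub_D1_residue` text) — §7 ν-bookkeeping helpers for lane A4.  Part 1 = `…D1TailCertDefs`.
-/

set_option linter.dupNamespace false

namespace Summit.AnomalousDissipation.AnomalousDissipation.Theorems.SolenoidalFractalHomogenisation.LagrangianStep.D1TailCert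

open Summit.AnomalousDissipation.AnomalousDissipation.Theorems
open Summit.AnomalousDissipation.AnomalousDissipation.Theorems.SolenoidalFractalHomogenisation.LagrangianStep
open Summit.AnomalousDissipation.AnomalousDissipation.Theorems.SolenoidalFractalHomogenisation.LagrangianStep.WCrossing
open Summit.AnomalousDissipation.AnomalousDissipation.Theorems.SolenoidalFractalHomogenisation.LagrangianStep.WEvenCert
open Summit.AnomalousDissipation.AnomalousDissipation.Theorems.SolenoidalFractalHomogenisation.LagrangianStep.D1ResidueCert
open Literature.Analysis Literature.Analysis.FluidPDE Literature.Analysis.FunctionSpaces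
open Set Real

noncomputable section

/-! ## §5 The Frobenius weights of the two tables are below `(1/23)²` -/

/-- Generic product-table bound: `g j j' = G₀·A j·B j'·e^{−θmin}` with `A j²/w_j ≤ UA`, `B j²/w_j ≤ UB` ⇒
`Σ_{jj'} g²/(w w') ≤ 676·G₀²·e^{−2θmin}·UA·UB`. -/
theorem frob_product_le {A B : Fin 26 → ℝ} {UA UB : ℝ} (hA : ∀ j, A j ^ 2 / wN j ≤ UA) (hB : ∀ j, B j ^ 2 / wN j ≤ UB) :
    ∑ j, ∑ j', (G0 * A j * B j' * Real.exp (-θmin)) ^ 2 / (wN j * wN j')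
      ≤ 676 * ((G0 * Real.exp (-θmin)) ^ 2 * (UA * UB)) := by
  have hUA : 0 ≤ UA := le_trans (div_nonneg (sq_nonneg _) (wN_pos 0).le) (hA 0)
  have hterm : ∀ j j', (G0 * A j * B j' * Real.exp (-θmin)) ^ 2 / (wN j * wN j')
      ≤ (G0 * Real.exp (-θmin)) ^ 2 * (UA * UB) := fun j j' => by
    have e : (G0 * A j * B j' * Real.exp (-θmin)) ^ 2 / (wN j * wN j')
        = (G0 * Real.exp (-θmin)) ^ 2 * ((A j ^ 2 / wN j) * (B j' ^ 2 / wN j')) := by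
      rw [mul_pow, mul_pow, mul_pow, div_mul_div_comm]; ring
    rw [e]
    refine mul_le_mul_of_nonneg_left ?_ (sq_nonneg _)
    exact mul_le_mul (hA j) (hB j') (div_nonneg (sq_nonneg _) (wN_pos j').le) hUA
  calc ∑ j, ∑ j', (G0 * A j * B j' * Real.exp (-θmin)) ^ 2 / (wN j * wN j')
      ≤ ∑ _j : Fin 26, ∑ _j' : Fin 26, (G0 * Real.exp (-θmin)) ^ 2 * (UA * UB) :=
        Finset.sum_le_sum fun j _ => Finset.sum_le_sum fun j' _ => hterm j j'
    _ = 676 * ((G0 * Real.exp (-θmin)) ^ 2 * (UA * UB)) := by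
        rw [Finset.sum_const, Finset.sum_const, Finset.card_univ, Fintype.card_fin]; simp; ring

/-- `(G₀·e^{−θmin})² ≤ (1/(16·97·3720))²·10⁻²⁴`. -/
theorem G0_exp_sq_le : (G0 * Real.exp (-θmin)) ^ 2 ≤ (1 / (16 * 97 * 3720)) ^ 2 * (1 / 10 ^ 12) ^ 2 := by
  obtain ⟨hG0, hG⟩ := G0_encl
  have he := exp_neg_θmin_le
  have he0 := exp_neg_θmin_pos
  rw [mul_pow]
  exact mul_le_mul (pow_le_pow_left₀ hG0.le hG 2) (pow_le_pow_left₀ he0.le he 2) (by positivity) (by positivity)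

/-- **THE NUMBER OF RECORD: `Σ_{jj'} gTab²/(w_j w_{j'}) ≤ (1/23)²`** (true value `(1.243·10⁻⁷)²`; this chain certifies `≤ (1.1·10⁻⁶)²`). -/
theorem frob_gTab_le : ∑ j, ∑ j', gTab j j' ^ 2 / (wN j * wN j') ≤ (1 / 23) ^ 2 := by
  have h := frob_product_le Apick_sq_div_le Bst_sq_div_le
  have h2 := G0_exp_sq_le
  calc ∑ j, ∑ j', gTab j j' ^ 2 / (wN j * wN j')
      = ∑ j, ∑ j', (G0 * Apick j * Bst j' * Real.exp (-θmin)) ^ 2 / (wN j * wN j') := rfl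
    _ ≤ 676 * ((G0 * Real.exp (-θmin)) ^ 2 * ((12 * 10 ^ 8) * (44 * 10 ^ 12))) := h
    _ ≤ 676 * (((1 / (16 * 97 * 3720)) ^ 2 * (1 / 10 ^ 12) ^ 2) * ((12 * 10 ^ 8) * (44 * 10 ^ 12))) := by
        gcongr
    _ ≤ (1 / 23) ^ 2 := by norm_num

/-- The crude table is certified too: `Σ_{jj'} gTabC²/(w_j w_{j'}) ≤ (1/23)²` (true value `(8.3·10⁻⁴)²`; this chain certifies `≤ (7.9·10⁻³)²`). -/
theorem frob_gTabC_le : ∑ j, ∑ j', gTabC j j' ^ 2 / (wN j * wN j') ≤ (1 / 23) ^ 2 := by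
  have h := frob_product_le ApickC_sq_div_le Bst_sq_div_le
  have h2 := G0_exp_sq_le
  calc ∑ j, ∑ j', gTabC j j' ^ 2 / (wN j * wN j')
      = ∑ j, ∑ j', (G0 * ApickC j * Bst j' * Real.exp (-θmin)) ^ 2 / (wN j * wN j') := rfl
    _ ≤ 676 * ((G0 * Real.exp (-θmin)) ^ 2 * ((7 * 10 ^ 16) * (44 * 10 ^ 12))) := h
    _ ≤ 676 * (((1 / (16 * 97 * 3720)) ^ 2 * (1 / 10 ^ 12) ^ 2) * ((7 * 10 ^ 16) * (44 * 10 ^ 12))) := by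
        gcongr
    _ ≤ (1 / 23) ^ 2 := by norm_num

/-- Transposed tables (source/pickup roles swapped in the identification) are certified by `frob_transpose`. -/
theorem frob_gTab_transpose_le : ∑ j, ∑ j', gTab j' j ^ 2 / (wN j * wN j') ≤ (1 / 23) ^ 2 := by
  rw [frob_transpose]; exact frob_gTab_le

/-- `gTab ≥ 0`, `gTabC ≥ 0`. -/
theorem gTab_nonneg (j j' : Fin 26) : 0 ≤ gTab j j' ∧ 0 ≤ gTabC j j' := by
  obtain ⟨hG0, -⟩ := G0_encl
  have h1 := norm_m_pos j; have h2 := norm_m_pos j'; have h3 := tau_pos j; have h4 := θs_pos j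
  unfold gTab gTabC Apick ApickC Bst
  constructor <;> positivity

/-! ## §6 Composition with the landed socket: the registered texts from the slot-pair bounds -/

/-- `(1/23)·ρP = 1/200000` (`ρP = 115/10⁶`): the socket size at `ε = 1/23` is exactly the registered `ρT`. -/
theorem one_div_23_mul_ρP : (1 / 23 : ℝ) * ρP = 1 / 200000 := by unfold ρP; norm_num

/-- **Generic composition.**  ANY table `g` with Frobenius weight `≤ (1/23)²`: a slot-pair presentation of `bsymb R` with per-pair bounds
`|F_{jj'}(p,q)| ≤ g j j'·|P_j p|·|P_{j'} q|` makes `R` `RelSmall` of size `1/200000` relative to `excQS` on the sectorial block window. -/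
theorem relSmall_tail_of_table {R S : T4} {g : Fin 26 → Fin 26 → ℝ} (hg : ∑ j, ∑ j', g j j' ^ 2 / (wN j * wN j') ≤ (1 / 23) ^ 2)
    (hS : Torus.NearIso S (10 / 11) (11 / 10)) {τ : ℝ} (hτ : τ ∈ Set.Icc (0:ℝ) (1 / 20)) (hodd : OddSectorial S τ)
    (F : (Fin 3 → ℝ) → (Fin 3 → ℝ) → Fin 26 → Fin 26 → ℝ)
    (hstruct : ∀ k p q : Fin 3 → ℝ, ∑ i, p i * k i = 0 → ∑ i, q i * k i = 0 →
      Torus.bsymb R k p q = ∑ j, ∑ j', ek j k * ek j' k * F p q j j')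
    (hbound : ∀ p q : Fin 3 → ℝ, ∀ j j', |F p q j j'| ≤ g j j' * (Real.sqrt (PpSq j p) * Real.sqrt (PpSq j' q))) :
    RelSmall R (excQS cubatureWord MB S) (1 / 200000) := by
  rw [← one_div_23_mul_ρP]
  exact relSmall_of_Nbar hS hτ hodd fun k p q hp hq => sq_le_of_slotPair (hstruct k p q hp hq) (hbound p q) hg

/-- **THE REGISTERED v17 TEXT `stub_D1_residueTail` FROM THE SLOT-PAIR BOUNDS (table of record `gTab`).**
`hstruct` = lane A1 (the slot-pair presentation of the tail's bilinear symbol on transverse pairs; `F` may depend on `ν`, `S`),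
`hbound` = lane A4 (the 676 per-pair bounds, cases A–E of the memo).  Conclusion: the registered stub text verbatim. -/
theorem residueTail_of_slotPairBounds
    (F : ℝ → T4 → (Fin 3 → ℝ) → (Fin 3 → ℝ) → Fin 26 → Fin 26 → ℝ)
    (hstruct : ∀ ν ∈ Set.Ioc 0 νB₁, ∀ S : Torus.Visc4 (Fin 3), Torus.NearIso S (10 / 11) (11 / 10) →
      ∀ τ ∈ Set.Icc (0:ℝ) (1 / 20), OddSectorial S τ → ∀ k p q : Fin 3 → ℝ, ∑ i, p i * k i = 0 → ∑ i, q i * k i = 0 →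
        Torus.bsymb (Sideband.psiStar cubatureWord MB MB_pos ν S - excQS cubatureWord MB S - pairQS S) k p q
          = ∑ j, ∑ j', ek j k * ek j' k * F ν S p q j j')
    (hbound : ∀ ν ∈ Set.Ioc 0 νB₁, ∀ S : Torus.Visc4 (Fin 3), Torus.NearIso S (10 / 11) (11 / 10) →
      ∀ τ ∈ Set.Icc (0:ℝ) (1 / 20), OddSectorial S τ →
        ∀ p q : Fin 3 → ℝ, ∀ j j', |F ν S p q j j'| ≤ gTab j j' * (Real.sqrt (PpSq j p) * Real.sqrt (PpSq j' q))) :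
    ∀ ν ∈ Set.Ioc 0 νB₁, ∀ S : Torus.Visc4 (Fin 3), Torus.NearIso S (10 / 11) (11 / 10) →
      ∀ τ ∈ Set.Icc (0:ℝ) (1 / 20), OddSectorial S τ →
        RelSmall (Sideband.psiStar cubatureWord MB MB_pos ν S - excQS cubatureWord MB S - pairQS S)
          (excQS cubatureWord MB S) (1 / 200000) :=
  fun ν hν S hS τ hτ hodd =>
    relSmall_tail_of_table frob_gTab_le hS hτ hodd (F ν S) (hstruct ν hν S hS τ hτ hodd) (hbound ν hν S hS τ hτ hodd)

/-- The same with the CRUDE table `gTabC` (pickup bound without in-slot decay). -/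
theorem residueTail_of_slotPairBounds_crude
    (F : ℝ → T4 → (Fin 3 → ℝ) → (Fin 3 → ℝ) → Fin 26 → Fin 26 → ℝ)
    (hstruct : ∀ ν ∈ Set.Ioc 0 νB₁, ∀ S : Torus.Visc4 (Fin 3), Torus.NearIso S (10 / 11) (11 / 10) →
      ∀ τ ∈ Set.Icc (0:ℝ) (1 / 20), OddSectorial S τ → ∀ k p q : Fin 3 → ℝ, ∑ i, p i * k i = 0 → ∑ i, q i * k i = 0 →
        Torus.bsymb (Sideband.psiStar cubatureWord MB MB_pos ν S - excQS cubatureWord MB S - pairQS S) k p q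
          = ∑ j, ∑ j', ek j k * ek j' k * F ν S p q j j')
    (hbound : ∀ ν ∈ Set.Ioc 0 νB₁, ∀ S : Torus.Visc4 (Fin 3), Torus.NearIso S (10 / 11) (11 / 10) →
      ∀ τ ∈ Set.Icc (0:ℝ) (1 / 20), OddSectorial S τ →
        ∀ p q : Fin 3 → ℝ, ∀ j j', |F ν S p q j j'| ≤ gTabC j j' * (Real.sqrt (PpSq j p) * Real.sqrt (PpSq j' q))) :
    ∀ ν ∈ Set.Ioc 0 νB₁, ∀ S : Torus.Visc4 (Fin 3), Torus.NearIso S (10 / 11) (11 / 10) →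
      ∀ τ ∈ Set.Icc (0:ℝ) (1 / 20), OddSectorial S τ →
        RelSmall (Sideband.psiStar cubatureWord MB MB_pos ν S - excQS cubatureWord MB S - pairQS S)
          (excQS cubatureWord MB S) (1 / 200000) :=
  fun ν hν S hS τ hτ hodd =>
    relSmall_tail_of_table frob_gTabC_le hS hτ hodd (F ν S) (hstruct ν hν S hS τ hτ hodd) (hbound ν hν S hS τ hτ hodd)

/-- **The v16 `stub_D1_residue` text** (all `a > 0`) from the same two inputs, through `D1ResidueCert.D1Residue_of_Nbar_tail` (ε = 1/23). -/
theorem D1Residue_of_slotPairBounds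
    (F : ℝ → T4 → (Fin 3 → ℝ) → (Fin 3 → ℝ) → Fin 26 → Fin 26 → ℝ)
    (hstruct : ∀ ν ∈ Set.Ioc 0 νB₁, ∀ S : Torus.Visc4 (Fin 3), Torus.NearIso S (10 / 11) (11 / 10) →
      ∀ τ ∈ Set.Icc (0:ℝ) (1 / 20), OddSectorial S τ → ∀ k p q : Fin 3 → ℝ, ∑ i, p i * k i = 0 → ∑ i, q i * k i = 0 →
        Torus.bsymb (Sideband.psiStar cubatureWord MB MB_pos ν S - excQS cubatureWord MB S - pairQS S) k p q
          = ∑ j, ∑ j', ek j k * ek j' k * F ν S p q j j')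
    (hbound : ∀ ν ∈ Set.Ioc 0 νB₁, ∀ S : Torus.Visc4 (Fin 3), Torus.NearIso S (10 / 11) (11 / 10) →
      ∀ τ ∈ Set.Icc (0:ℝ) (1 / 20), OddSectorial S τ →
        ∀ p q : Fin 3 → ℝ, ∀ j j', |F ν S p q j j'| ≤ gTab j j' * (Real.sqrt (PpSq j p) * Real.sqrt (PpSq j' q))) :
    ∀ a > (0:ℝ), ∀ ν ∈ Set.Ioc 0 νB₁, ∀ S : Torus.Visc4 (Fin 3), Torus.NearIso S (10 / 11) (11 / 10) →
      ∀ τ ∈ Set.Icc (0:ℝ) (1 / 20), OddSectorial S τ →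
        RelSmall (ΨB₁ a ν S - ΦB a S) (ΦB a S) ρB :=
  D1Residue_of_Nbar_tail (ε := 1 / 23) (by norm_num) le_rfl fun ν hν S hS τ hτ hodd k p q hp hq =>
    sq_le_of_slotPair (hstruct ν hν S hS τ hτ hodd k p q hp hq) (hbound ν hν S hS τ hτ hodd p q) frob_gTab_le

/-! ## §7 Helpers for lane A4 (the ν-bookkeeping of the per-pair bounds) -/

/-- For `0 < ν ≤ 1/40` the dissipativity rate `min γ₁ (4π²·lo')` with `γ₁ = 1`, `lo' = ν·(10/11)` is the viscous one. -/
theorem min_one_viscRate {ν : ℝ} (hν : ν ∈ Set.Ioc (0:ℝ) (1 / 40)) :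
    min (1:ℝ) (4 * π ^ 2 * (ν * (10 / 11))) = 4 * π ^ 2 * (ν * (10 / 11)) := by
  obtain ⟨-, hhi⟩ := pi_sq_encl
  refine min_eq_right ?_
  have := hν.2
  nlinarith [Real.pi_pos]

/-- The per-slot exponent: `r·L_j = θ_j` with `r = 4π²ν(10/11)`, `L_j = MB·τ_j/ν`. -/
theorem viscRate_mul_slotLen {ν : ℝ} (hν : 0 < ν) (j : Fin 26) :
    4 * π ^ 2 * (ν * (10 / 11)) * (MB * (cubatureWord.phase j).τ / ν) = θs j := by
  unfold θs; field_simp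

/-- Every slot exponent dominates `θmin`: `θmin ≤ θ_j` (so `e^{−θ_j} ≤ e^{−θmin}` for every full slot crossed). -/
theorem θmin_le_θs (j : Fin 26) : θmin ≤ θs j := by
  unfold θmin θs MB
  have hπ : 0 < π ^ 2 := by positivity
  rcases class_data j with ⟨-, h⟩ | ⟨-, h⟩ | ⟨-, h⟩ <;> rw [h] <;> nlinarith

/-- `e^{−θ_j} ≤ e^{−θmin}`. -/
theorem exp_neg_θs_le (j : Fin 26) : Real.exp (-θs j) ≤ Real.exp (-θmin) :=
  Real.exp_le_exp.mpr (neg_le_neg (θmin_le_θs j))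

/-- A sum of slot exponents over a NONEMPTY set of crossed slots dominates `θmin`. -/
theorem θmin_le_sum {s : Finset (Fin 26)} (hs : s.Nonempty) : θmin ≤ ∑ j ∈ s, θs j := by
  obtain ⟨i, hi⟩ := hs
  calc θmin ≤ θs i := θmin_le_θs i
    _ ≤ ∑ j ∈ s, θs j := Finset.single_le_sum (fun j _ => (θs_pos j).le) hi

/-- The tent Laplace factor is below `2/c²`: `2(1 − e^{−c/2})²/c² ≤ 2/c²` for `c > 0`. -/
theorem tentK_le {c : ℝ} (hc : 0 < c) : 2 * (1 - Real.exp (-(c / 2))) ^ 2 / c ^ 2 ≤ 2 / c ^ 2 := by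
  apply div_le_div_of_nonneg_right _ (by positivity)
  have h0 : 0 ≤ 1 - Real.exp (-(c / 2)) := by
    have : Real.exp (-(c / 2)) ≤ 1 := Real.exp_le_one_iff.mpr (by linarith)
    linarith
  have h1 : 1 - Real.exp (-(c / 2)) ≤ 1 := by have := Real.exp_pos (-(c / 2)); linarith
  nlinarith

/-- The global prefactor assembled from the ν-dependent pieces: `(ν/4π²)·(1/P₁)·L_j·(1/r) = G₀·τ_j·(11/10)` with `P₁ = P·MB/ν`,
`L_j = MB τ_j/ν`, `r = 4π²ν(10/11)` (`P = cubatureWord.period`). -/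
theorem prefactor_eq {ν : ℝ} (hν : 0 < ν) (j : Fin 26) :
    ν / (4 * π ^ 2) * (1 / (cubatureWord.period * MB / ν)) * (MB * (cubatureWord.phase j).τ / ν) * (1 / (4 * π ^ 2 * (ν * (10 / 11))))
      = G0 * (cubatureWord.phase j).τ * (11 / 10) := by
  unfold G0
  rw [period_cubatureWord]
  have hπ : π ≠ 0 := Real.pi_pos.ne'
  have hM : MB ≠ 0 := MB_pos.ne'
  field_simp
  ring

end

end Summit.AnomalousDissipation.AnomalousDissipation.Theorems.SolenoidalFractalHomogenisation.LagrangianStep.D1TailCert
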